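import Summits.QuantumFields.QCD.Theorems.CoerciveSea.Negative.CellCoercivity

/-!
# Crux `CoerciveSea` (stmt-QuantumFields-13901), negative side, 3/4 — Dirichlet cell determinants
# are real, and positive off the hopping band

Support file of the standing disprover of the hinge crux `CoerciveSea` (route `NestedDissectionSea`).
`det_compressed_im`: EVERY principal submatrix of the `r = 1` Wilson–Dirac matrix has real
determinant (γ₅-hermiticity restricts because `Γ₅ = spinorLift γ₅` is diagonal) — the substance of
route item `DirichletDetReal` (stmt-QuantumFields-11275; attached there as evidence, a prover lands
it); `det_compressed_re_pos`: for index sets cut out by a SITE predicate the determinant is POSITIVE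
whenever `|μ + 4| > 4` (cell twin of Seiler positivity: coercive homotopy, reality, IVT, even
cardinality); consequences `cellDetRe_pos`, `not_isSignDefect` (no box is a sign defect at
`|μ+4| > 4`: clause (ii) of `CoerciveSea` is EMPTY at positive valence masses), `det_wilsonCell_im`.
Standard material. [folklore]
-/

noncomputable section

open scoped BigOperators ComplexConjugate Kronecker
open MeasureTheory Filter Matrix
open Literature.MathematicalPhysics.QuantumLattice Literature.MathematicalPhysics.QuantumFieldTheory
  Literature.Probability.LatticeModels

namespace Summit.QuantumFields.QCD.Theorems.CoerciveSeaNegative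

/-! ### B.3 Dirichlet cell determinants are real (γ₅-hermiticity restricted) -/

section DetReal

variable {L N : ℕ} [NeZero L] {G : Type*} [Group G] (ρ : G →* Matrix (Fin N) (Fin N) ℂ)

omit [NeZero L] [Group G] in
/-- Chirality signs `γ₅ = diag(1,1,−1,−1)` square to one. [folklore] -/
theorem chiSign_sq (k : Fin 4) : (![1, 1, -1, -1] : Fin 4 → ℂ) k * (![1, 1, -1, -1] : Fin 4 → ℂ) k = 1 := by
  fin_cases k <;> simp

omit [NeZero L] in
/-- `Γ₅ = spinorLift γ₅` is the diagonal matrix of chirality signs (read off the spin index). [folklore] -/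
theorem spinorLift_gammaFive :
    (spinorLift gammaFive : Matrix (TorusSite 4 L × Fin N × Fin 4) _ ℂ) =
      diagonal fun q => (![1, 1, -1, -1] : Fin 4 → ℂ) q.2.2 := by
  ext p q
  rcases p with ⟨x, a, α⟩
  rcases q with ⟨y, b, β⟩
  simp only [spinorLift, gammaFive_eq_diagonal, Matrix.kroneckerMap_apply, Matrix.one_apply,
    Matrix.diagonal_apply, Prod.mk.injEq]
  by_cases hx : x = y <;> by_cases ha : a = b <;> by_cases hα : α = β <;> simp [hx, ha, hα]

/-- γ₅-hermiticity entrywise: `conj D_{ji} = χ_i D_{ij} χ_j`, `χ` the chirality sign of the spin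
index. [folklore] -/
theorem conj_wilsonDirac_apply (hρ : ∀ g, ρ g ∈ Matrix.unitaryGroup (Fin N) ℂ)
    (U : GaugeConfig 4 L G) (m : ℝ) (i j : TorusSite 4 L × Fin N × Fin 4) :
    conj (wilsonDirac ρ U m 1 j i) =
      (![1, 1, -1, -1] : Fin 4 → ℂ) i.2.2 * wilsonDirac ρ U m 1 i j * (![1, 1, -1, -1] : Fin 4 → ℂ) j.2.2 := by
  have h := wilsonDirac_gammaFive_hermitian_holds (L := L) ρ hρ U m 1
  rw [spinorLift_gammaFive] at h
  have hij := congrFun (congrFun h i) j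
  rw [Matrix.mul_diagonal, Matrix.diagonal_mul, Matrix.conjTranspose_apply] at hij
  rw [hij]
  rfl

/-- **Every principal submatrix of the Wilson–Dirac matrix has real determinant** (the substance
of route item `DirichletDetReal`, for an ARBITRARY index subset, not only site sets): the
compressed matrix is again `Γ₅`-hermitian because `Γ₅` is diagonal, so `conj det = det`. [folklore] -/
theorem det_compressed_im (hρ : ∀ g, ρ g ∈ Matrix.unitaryGroup (Fin N) ℂ)
    (U : GaugeConfig 4 L G) (m : ℝ) (p : TorusSite 4 L × Fin N × Fin 4 → Prop) [DecidablePred p] :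
    (((wilsonDirac ρ U m 1).toSquareBlockProp p).det).im = 0 := by
  set Dc := (wilsonDirac ρ U m 1).toSquareBlockProp p with hDc
  set Γc : Matrix {a // p a} {a // p a} ℂ :=
    diagonal fun a => (![1, 1, -1, -1] : Fin 4 → ℂ) a.1.2.2 with hΓc
  have hherm : Dcᴴ = Γc * Dc * Γc := by
    ext i j
    rw [Matrix.conjTranspose_apply, hΓc, Matrix.mul_diagonal, Matrix.diagonal_mul, hDc,
      toSquareBlockProp_def, Matrix.of_apply, Matrix.of_apply]
    exact conj_wilsonDirac_apply ρ hρ U m i j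
  have hΓdet : Γc.det * Γc.det = 1 := by
    rw [hΓc, det_diagonal, ← Finset.prod_mul_distrib]
    exact Finset.prod_eq_one fun a _ => chiSign_sq a.1.2.2
  have hstar : star Dc.det = Dc.det := by
    rw [← det_conjTranspose, hherm, det_mul, det_mul]
    linear_combination Dc.det * hΓdet
  exact Complex.conj_eq_iff_im.mp hstar

end DetReal

/-! ### B.4 Dirichlet cell determinants are positive off the hopping band `|μ+4| ≤ 4` -/

section DetPos

variable {L N : ℕ} [NeZero L] {G : Type*} [Group G] (ρ : G →* Matrix (Fin N) (Fin N) ℂ)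

/-- Index subsets cut out by a SITE predicate (boxes, site sets) have even cardinality
(`N` colours × 4 spins per site). [folklore] -/
theorem even_card_sitePred (P : TorusSite 4 L → Prop) [DecidablePred P] :
    Even (Fintype.card {q : TorusSite 4 L × Fin N × Fin 4 // P q.1}) := by
  rw [Fintype.card_congr (Equiv.prodSubtypeFstEquivSubtypeProd (p := P) (β := Fin N × Fin 4)),
    Fintype.card_prod, Fintype.card_prod, Fintype.card_fin, Fintype.card_fin]
  exact ((show Even 4 from ⟨2, rfl⟩).mul_left N).mul_left _

/-- The cell homotopy matrix `1 − (t/(μ+4)) K_c` has non-zero determinant for `|μ+4| > 4`,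
`t ∈ [0,1]`: a kernel vector would give `‖v‖² = (t/(μ+4)) Re⟨v, K_c v⟩ ≤ (4t/|μ+4|)‖v‖² < ‖v‖²`.
[folklore] -/
theorem det_cellSeg_ne_zero (hρ : ∀ g, ρ g ∈ Matrix.unitaryGroup (Fin N) ℂ) (U : GaugeConfig 4 L G)
    (p : TorusSite 4 L × Fin N × Fin 4 → Prop) [DecidablePred p] {μ t : ℝ} (hμ : 4 < |μ + 4|)
    (ht0 : 0 ≤ t) (ht1 : t ≤ 1) :
    ((1 : Matrix {a // p a} {a // p a} ℂ) -
        ((t / (μ + 4) : ℝ) : ℂ) • (∑ ν, wilsonHop ρ U ν).toSquareBlockProp p).det ≠ 0 := by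
  intro hdet
  obtain ⟨v, hv, hKv⟩ := Matrix.exists_mulVec_eq_zero_iff.mpr hdet
  set Kc := (∑ ν, wilsonHop ρ U ν).toSquareBlockProp p with hKc
  set n2 := ∑ a, ‖v a‖ ^ 2 with hn2
  have hn2_pos : 0 < n2 := by
    obtain ⟨a, ha⟩ : ∃ a, v a ≠ 0 := by
      by_contra hall; push Not at hall; exact hv (funext hall)
    have ha' : 0 < ‖v a‖ := norm_pos_iff.mpr ha
    exact Finset.sum_pos' (fun a _ => by positivity) ⟨a, Finset.mem_univ _, by positivity⟩
  -- 0 = Σ conj(v) ((1 - c Kc) v) = n2 - c Σ conj v (Kc v)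
  have hsum : ∑ a, conj (v a) * (((1 : Matrix _ _ ℂ) - ((t / (μ + 4) : ℝ) : ℂ) • Kc) *ᵥ v) a = 0 := by
    rw [hKv]; simp
  rw [Matrix.sub_mulVec, Matrix.smul_mulVec, Matrix.one_mulVec] at hsum
  simp only [Pi.sub_apply, Pi.smul_apply, smul_eq_mul, mul_sub, Finset.sum_sub_distrib] at hsum
  have h1 : ∑ a, conj (v a) * v a = ((n2 : ℝ) : ℂ) := by
    rw [hn2, Complex.ofReal_sum]
    exact Finset.sum_congr rfl fun a _ => by rw [Complex.conj_mul' (v a)]; push_cast; ring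
  have h2 : ∑ a, conj (v a) * (((t / (μ + 4) : ℝ) : ℂ) * (Kc *ᵥ v) a) =
      ((t / (μ + 4) : ℝ) : ℂ) * ∑ a, conj (v a) * (Kc *ᵥ v) a := by
    rw [Finset.mul_sum]; exact Finset.sum_congr rfl fun a _ => by ring
  rw [h1, h2, sub_eq_zero] at hsum
  have hb := norm_inner_hop_compressed_le ρ hρ U p v
  rw [← hKc] at hb
  have h4pos : (0 : ℝ) < |μ + 4| := by linarith
  have hnorm := congrArg (fun z : ℂ => ‖z‖) hsum
  simp only [Complex.norm_real, Real.norm_eq_abs, norm_mul, abs_div] at hnorm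
  rw [abs_of_pos hn2_pos, abs_of_nonneg ht0] at hnorm
  have : n2 ≤ t / |μ + 4| * (4 * n2) :=
    calc n2 = _ := hnorm
      _ ≤ t / |μ + 4| * (4 * n2) := mul_le_mul_of_nonneg_left hb (by positivity)
  have hlt : t / |μ + 4| * 4 < 1 := by
    rw [div_mul_eq_mul_div, div_lt_one h4pos]; nlinarith
  nlinarith

omit [NeZero L] in
/-- For `t ≠ 0` the cell homotopy matrix is `t/(μ+4)` times the compressed Wilson–Dirac matrix
at bare mass `(μ+4)/t − 4`. [folklore] -/
theorem cellSeg_eq_smul (hρ : ∀ g, ρ g ∈ Matrix.unitaryGroup (Fin N) ℂ) (U : GaugeConfig 4 L G)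
    (p : TorusSite 4 L × Fin N × Fin 4 → Prop) [DecidablePred p] {μ t : ℝ} (hμ : μ + 4 ≠ 0)
    (ht : t ≠ 0) :
    ((1 : Matrix {a // p a} {a // p a} ℂ) -
        ((t / (μ + 4) : ℝ) : ℂ) • (∑ ν, wilsonHop ρ U ν).toSquareBlockProp p) =
      ((t / (μ + 4) : ℝ) : ℂ) • (wilsonDirac ρ U ((μ + 4) / t - 4) 1).toSquareBlockProp p := by
  rw [wilsonDirac_eq_sub_sum_wilsonHop ρ hρ, toSquareBlockProp_smul_one_sub, smul_sub, smul_smul,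
    ← Complex.ofReal_mul, show t / (μ + 4) * ((μ + 4) / t - 4 + 4) = 1 by field_simp; ring,
    Complex.ofReal_one, one_smul]

/-- `det` of the cell homotopy matrix is real. [folklore] -/
theorem det_cellSeg_im (hρ : ∀ g, ρ g ∈ Matrix.unitaryGroup (Fin N) ℂ) (U : GaugeConfig 4 L G)
    (p : TorusSite 4 L × Fin N × Fin 4 → Prop) [DecidablePred p] {μ t : ℝ} (hμ : μ + 4 ≠ 0) :
    (((1 : Matrix {a // p a} {a // p a} ℂ) -
        ((t / (μ + 4) : ℝ) : ℂ) • (∑ ν, wilsonHop ρ U ν).toSquareBlockProp p).det).im = 0 := by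
  rcases eq_or_ne t 0 with h | ht
  · subst h; simp
  · rw [cellSeg_eq_smul ρ hρ U p hμ ht, det_smul]
    have hreal := det_compressed_im ρ hρ U ((μ + 4) / t - 4) p
    set d := ((wilsonDirac ρ U ((μ + 4) / t - 4) 1).toSquareBlockProp p).det with hd
    have hd' : d = ((d.re : ℝ) : ℂ) := Complex.ext (by simp) (by simpa using hreal)
    rw [hd', ← Complex.ofReal_pow, ← Complex.ofReal_mul, Complex.ofReal_im]

/-- **Dirichlet cell determinants are positive off the hopping band.** For a SITE predicate `P`
(any box / site set), every gauge field and every bare mass with `|μ + 4| > 4` (`μ > 0` or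
`μ < −8`), `Re det (D_W)_c > 0` for the principal submatrix on `{q | P q.site}`: homotopy
`t ↦ 1 − (t/(μ+4))K_c` (non-singular by coercivity, real by γ₅, `= 1` at `t = 0`) and
`det D_c = (μ+4)^{n_c} det(1 − K_c/(μ+4))` with `n_c` even. Consequence for the crux: at valence
masses `μ > 0` NO cell is a sign defect — clause (ii) is vacuous in the heavy junk corner. [folklore] -/
theorem det_compressed_re_pos (hρ : ∀ g, ρ g ∈ Matrix.unitaryGroup (Fin N) ℂ) (U : GaugeConfig 4 L G)
    (P : TorusSite 4 L → Prop) [DecidablePred P] {μ : ℝ} (hμ : 4 < |μ + 4|) :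
    0 < (((wilsonDirac ρ U μ 1).toSquareBlockProp fun q => P q.1).det).re := by
  have hμ4 : μ + 4 ≠ 0 := fun h => by rw [h, abs_zero] at hμ; linarith
  set p : TorusSite 4 L × Fin N × Fin 4 → Prop := fun q => P q.1 with hp
  set Kc := (∑ ν, wilsonHop ρ U ν).toSquareBlockProp p with hKc
  set g : ℝ → ℝ := fun t =>
    (((1 : Matrix {a // p a} {a // p a} ℂ) - ((t / (μ + 4) : ℝ) : ℂ) • Kc).det).re with hgdef
  have hcont : Continuous fun t : ℝ =>
      ((1 : Matrix {a // p a} {a // p a} ℂ) - ((t / (μ + 4) : ℝ) : ℂ) • Kc).det := by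
    have h : Continuous fun t : ℝ =>
        ((1 : Matrix {a // p a} {a // p a} ℂ) - ((t / (μ + 4) : ℝ) : ℂ) • Kc) := by
      refine continuous_const.sub ?_
      exact (Complex.continuous_ofReal.comp (continuous_id.div_const (μ + 4))).smul
        continuous_const
    exact h.matrix_det
  have hg : Continuous g := Complex.continuous_re.comp hcont
  have hg0 : g 0 = 1 := by simp [hgdef]
  have hne : ∀ t ∈ Set.Icc (0 : ℝ) 1, g t ≠ 0 := by
    intro t ht h0
    apply det_cellSeg_ne_zero ρ hρ U p hμ ht.1 ht.2
    exact Complex.ext (by simpa [hgdef] using h0) (by simpa using det_cellSeg_im ρ hρ U p hμ4)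
  have hg1 : 0 < g 1 := by
    refine lt_of_not_ge fun hle => ?_
    have hmem : (0 : ℝ) ∈ Set.Icc (g 1) (g 0) := ⟨hle, by rw [hg0]; norm_num⟩
    obtain ⟨t, ht, ht0⟩ := intermediate_value_Icc' zero_le_one hg.continuousOn hmem
    exact hne t ht ht0
  have hD : (wilsonDirac ρ U μ 1).toSquareBlockProp p =
      ((μ + 4 : ℝ) : ℂ) • ((1 : Matrix {a // p a} {a // p a} ℂ) - ((1 / (μ + 4) : ℝ) : ℂ) • Kc) := by
    rw [smul_sub, smul_smul, ← Complex.ofReal_mul,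
      show (μ + 4) * (1 / (μ + 4)) = 1 by field_simp, Complex.ofReal_one, one_smul,
      wilsonDirac_eq_sub_sum_wilsonHop ρ hρ, toSquareBlockProp_smul_one_sub]
  have hdet : ((wilsonDirac ρ U μ 1).toSquareBlockProp p).det =
      (((μ + 4) ^ Fintype.card {a // p a} * g 1 : ℝ) : ℂ) := by
    rw [hD, det_smul]
    have him := det_cellSeg_im ρ hρ U p (t := 1) hμ4
    set d := ((1 : Matrix {a // p a} {a // p a} ℂ) - ((1 / (μ + 4) : ℝ) : ℂ) • Kc).det with hd
    have hd' : d = ((d.re : ℝ) : ℂ) := Complex.ext (by simp) (by simpa using him)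
    rw [hd', ← Complex.ofReal_pow, ← Complex.ofReal_mul]
  rw [hdet, Complex.ofReal_re]
  exact mul_pos ((even_card_sitePred P).pow_pos hμ4) hg1

end DetPos

/-! ### B.5 consequences for the crux vocabulary -/

/-- **The separator event sits inside the cell near-kernel event** — so clause (i) of `CoerciveSea`
follows from a Wegner-type law for the CELL operator `D_c`: a `τ`-singular separator yields a
non-zero `w` on the box with `‖D_c w‖² < τ² ‖w‖²` (i.e. `σ_min(D_c) < |τ|`), because for a vector
harmonic on the children interiors the full residual IS the separator residual. [folklore] -/
theorem hasSingularSeparator_cell_residual_lt {Nt : ℕ} [NeZero Nt]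
    {U : GaugeConfig 4 Nt (Matrix.specialUnitaryGroup (Fin 3) ℂ)} {μ τ : ℝ} {s : Fin 4 → ℕ}
    (h : HasSingularSeparator U μ s τ) :
    ∃ w : {p // wilsonBox (0 : TorusSite 4 Nt) s p} → ℂ, w ≠ 0 ∧
      ∑ p, ‖(wilsonCell U μ 0 s *ᵥ w) p‖ ^ 2 < τ ^ 2 * ∑ p, ‖w p‖ ^ 2 := by
  obtain ⟨w, ⟨p₀, -, hw₀⟩, hharm, hres⟩ := h
  refine ⟨w, fun h0 => hw₀ (by rw [h0]; rfl), ?_⟩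
  have hRfull : ∑ p, ‖(wilsonCell U μ 0 s *ᵥ w) p‖ ^ 2 =
      ∑ p, (if childrenInterior s p then 0 else ‖(wilsonCell U μ 0 s *ᵥ w) p‖ ^ 2) :=
    Finset.sum_congr rfl fun p _ => by
      split_ifs with hp
      · rw [hharm p hp]; simp
      · rfl
  have hsep_le : ∑ p, (if childrenInterior s p then 0 else ‖w p‖ ^ 2) ≤ ∑ p, ‖w p‖ ^ 2 :=
    Finset.sum_le_sum fun p _ => by
      split_ifs
      · positivity
      · exact le_rfl
  rw [hRfull]
  exact hres.trans_le (mul_le_mul_of_nonneg_left hsep_le (sq_nonneg τ))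

/-- `Re det` of every Dirichlet cell is positive off the hopping band. [folklore] -/
theorem cellDetRe_pos {Nt : ℕ} [NeZero Nt] (U : GaugeConfig 4 Nt (Matrix.specialUnitaryGroup (Fin 3) ℂ)) {μ : ℝ} (hμ : 4 < |μ + 4|)
    (x : TorusSite 4 Nt) (s : Fin 4 → ℕ) : 0 < cellDetRe U μ x s :=
  det_compressed_re_pos (fundamentalRep (Fin 3)) fundamentalRep_mem_unitaryGroup U (siteBox x s) hμ

/-- **No sign defects off the hopping band**: at bare masses with `|μ+4| > 4` (in particular all
`μ > 0`) no box at any scale is a sign defect, for ANY gauge field. [folklore] -/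
theorem not_isSignDefect {Nt : ℕ} [NeZero Nt] (U : GaugeConfig 4 Nt (Matrix.specialUnitaryGroup (Fin 3) ℂ)) {μ : ℝ} (hμ : 4 < |μ + 4|)
    (j : ℕ) (s : Fin 4 → ℕ) : ¬ IsSignDefect U μ j s := by
  have hprod : 0 < cellDetRe U μ 0 s * ∏ ε : Fin 4 → Bool, cellDetRe U μ (halfCorner s ε) (halfSides s ε) :=
    mul_pos (cellDetRe_pos U hμ 0 s) (Finset.prod_pos fun ε _ => cellDetRe_pos U hμ _ _)
  rintro (⟨-, h⟩ | ⟨-, h⟩)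
  · exact absurd h (not_lt.mpr (cellDetRe_pos U hμ 0 s).le)
  · exact absurd h (not_lt.mpr hprod.le)

/-- The Dirichlet determinant of every cell is real (route item `DirichletDetReal` in substance,
here for boxes). [folklore] -/
theorem det_wilsonCell_im {Nt : ℕ} [NeZero Nt] (U : GaugeConfig 4 Nt (Matrix.specialUnitaryGroup (Fin 3) ℂ)) (μ : ℝ) (x : TorusSite 4 Nt)
    (s : Fin 4 → ℕ) : (wilsonCell U μ x s).det.im = 0 :=
  det_compressed_im (fundamentalRep (Fin 3)) fundamentalRep_mem_unitaryGroup U μ (wilsonBox x s)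



end Summit.QuantumFields.QCD.Theorems.CoerciveSeaNegative

end
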